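import Summits.ABC.StewartYu.PadicG3TwoFrameNumerics
import Literature.NumberTheory.Transcendental.Waldschmidt1980Count
import HarnessLib

/-!
# Cell abc-stewartyu, Gen-3 frame at `p = 2` (crux `Y07Two`, stmt-ABC-19659), assembly: the frame reduced to the
# record WITH THE SHARP SIEGEL COUNT (`#{τ : |τ| < T} ≤ binom(T+d, d+1)`, not `T^{d+1}`)

`Summits/ABC/StewartYu/PadicG3TwoFrameNumericsSharp.lean` — cell `abc-stewartyu` (HOME `run/shared/lean/pub/abc-stewartyu/`),
route `PadicPrimesKummerThird`, seat p5 (g3); sequel to `PadicG3TwoFrameNumerics.lean`.  One `Prop`-structure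
(`FrameNumericsTwoC`) and theorems; no named fact.

WHY.  The level-`0` Siegel count of `PadicG3TwoBoxes.siegel_count` / `PadicG3TwoLevelZero.siegelTwo_feldman` /
`siegelTwo_feldman_scaled` / `FrameNumericsTwo.count` bounds the number of multi-indices by `T^{d+1}` (lit's
`card_tauSet_le`).  With `T = M ≍ (n+1)L` this charges the unknown count `L₀·Lⁿ/Ω` with `((n+1)L)ⁿ` instead of
print's `binom(M+n, n) ≤ (e(M+n)/n)ⁿ ≍ (cL)ⁿ` (Nesterenko (3.48); Yu 2013 (4.30)) — an `(n+1)ⁿ ≍ n!·eⁿ` loss that would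
propagate through the `Y₀`-line `L₀·G ≤ ε·G·X·L` into `L`, `U` and the crux constant: `(c·n)ⁿ` instead of `cⁿ`
(exactly the `why_might_fail` of crux stmt-ABC-19659).  Lit's `Waldschmidt1980Count.card_tauSet_le_choose`
(`#tauSet d T ≤ binom(T+d, d+1)`, the M2 record's fix of the same issue) gives the sharp count; this file threads it:
`card_eqSet_le_choose`, `siegel_count_choose`, `siegelTwo_feldman_scaled_choose`, and the record bundle
**`FrameNumericsTwoC`** (= `FrameNumericsTwo` with the binomial count) with `levels_of_numericsC`,
**`frameTwoLast_of_numericsC`**, **`stub_frameTwoLast_of_numericsC`** — USE THESE, not the `T^{d+1}` forms.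

WHAT THIS IS NOT: no numbers; no crux moves.

References: Yu. V. Nesterenko, LNM 1819 (2003), §3.5 (3.48); K. Yu, Acta Math. 211 (2013), (4.28)–(4.30);
M. Waldschmidt, Acta Arith. 37 (1980), §3 (the count of multi-indices).
-/

noncomputable section

open Finset Polynomial
open Literature.NumberTheory.Transcendental
open Literature.NumberTheory.Transcendental (FeldmanDelta.den)
open Literature.NumberTheory.Transcendental.FeldmanDelta
open Literature.NumberTheory.Transcendental.CW77.Setup (Tau tauNorm tauSet mem_tauSet)

namespace Summit.ABC.StewartYu

/-! ### The sharp count of the level-`0` equations -/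

namespace G3Boxes

/-- `eqSet d N T ⊆ [−N, N] × tauSet d T`. [folklore] -/
theorem eqSet_subset_product (d N T : ℕ) : eqSet d N T ⊆ (Icc (-(N : ℤ)) N) ×ˢ tauSet d T := by
  intro e he
  rw [mem_eqSet] at he
  rw [mem_product, mem_Icc, mem_tauSet]
  exact ⟨abs_le.mp he.1, he.2⟩

/-- **The sharp count**: `#eqSet ≤ (2N+1)·binom(T+d, d+1)`. [cite: Nesterenko2003, §3.5 (3.48); shape only] -/
theorem card_eqSet_le_choose (d N T : ℕ) : (eqSet d N T).card ≤ (2 * N + 1) * (T + d).choose (d + 1) := by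
  refine (card_le_card (eqSet_subset_product d N T)).trans ?_
  rw [card_product, Int.card_Icc]
  have : ((N : ℤ) + 1 - -(N : ℤ)).toNat = 2 * N + 1 := by omega
  rw [this]
  exact Nat.mul_le_mul_left _ (Waldschmidt1980.card_tauSet_le_choose d T)

/-- **The Siegel count with the sharp multi-index count**: from
`2·2^m·(2N+1)·binom(T+d, d+1) ≤ (L₀+1)·∏(2Dboxⱼ+1)·(2D_θ+1)`. [cite: Nesterenko2003, §3.5 (3.48); shape only] -/
theorem siegel_count_choose {d : ℕ} (m L₀ : ℕ) (Dbox : Fin d → ℕ) (Dθ N T : ℕ)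
    (h : 2 * 2 ^ m * ((2 * N + 1) * (T + d).choose (d + 1)) ≤
      (L₀ + 1) * ((∏ j, (2 * Dbox j + 1)) * (2 * Dθ + 1))) :
    2 * 2 ^ m * (eqSet d N T).card ≤ (famBox L₀ Dbox Dθ).card := by
  rw [card_famBox]
  exact (Nat.mul_le_mul_left _ (card_eqSet_le_choose d N T)).trans h

end G3Boxes

namespace TwoSetup

open Summit.ABC.StewartYu.FeldmanBasis Summit.ABC.StewartYu.G3Boxes

variable {S : TwoSetup} (σ : S.G3TwoSched)

/-- **LEVEL `0` FOR THE PRE-SCALED FEL'DMAN BASIS from the card inequality `2·2^m·#E₀ ≤ #box` directly** (any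
count lemma may feed it; `siegelTwo_feldman_scaled` is the `T^{d+1}` instance). [cite: Yu2013, Lemma 4.2 and (5.22)] -/
theorem siegelTwo_feldman_scaled_of_card (H L₀ : ℕ) (hH : 1 ≤ H)
    (hΛ : ‖S.Λ₀‖ ≤ ((2 : ℝ) ^ (σ.m + 3))⁻¹)
    (hT0 : 1 ≤ σ.T0 0)
    (hE : 2 * 2 ^ σ.m * (eqSet S.d (σ.N0 0) (σ.T0 0)).card ≤ (famBox L₀ (σ.Dbox 0) (σ.Dθ 0)).card)
    (hcardB : (famBox L₀ (σ.Dbox 0) (σ.Dθ 0)).card ≤ σ.cardB 0)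
    (hL : L₀ ≤ σ.D₀)
    (hXb : ∀ i ∈ famBox L₀ (σ.Dbox 0) (σ.Dθ 0), ∀ j, |S.dirScalar i.2.1 i.2.2 j| ≤ σ.Xb 0)
    (hBw : ∀ ℓ, ℓ ≤ L₀ → ‖((den ℓ H : ℚ_[2]))⁻¹‖ * (4 * (2 : ℝ) ^ σ.m) ^ ℓ ≤ σ.Bw 0)
    (hden₀ : ∀ (x : ℤ) (τ : Tau S.d), σ.den₀ 0 x τ = Nat.lcmUpto H ^ τ.1)
    (hM₀ : ∀ (x : ℤ) (τ : Tau S.d), ∀ ℓ, ℓ ≤ L₀ →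
      (3 : ℝ) ^ (σ.Istar * τ.1) * ((Nat.lcmUpto H : ℝ) ^ τ.1 *
        (Real.exp (H / Real.exp 1) * (Real.exp 1 * (1 + (3 : ℝ) ^ σ.Istar * |(x : ℝ)| / H)) ^ ℓ)) ≤
        σ.M₀ 0 x τ)
    {M₀E : ℤ} (hM₀E : ∀ e ∈ eqSet S.d (σ.N0 0) (σ.T0 0), σ.M₀ 0 e.1 e.2 ≤ M₀E)
    {Amax : ℝ} (hAmax : 1 ≤ Amax)
    (hA : ∀ e ∈ eqSet S.d (σ.N0 0) (σ.T0 0), (M₀E : ℝ) * (σ.Xb 0 : ℝ) ^ (∑ j, e.2.2 j) *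
      ((MonomialDen.monDen S.toQ.all (S.boxExp (σ.Dbox 0) (σ.Dθ 0) e.1) : ℝ)) ^ 2 ≤ Amax)
    (hP : ⌈((famBox L₀ (σ.Dbox 0) (σ.Dθ 0)).card : ℝ) * Amax⌉ ≤ σ.P) :
    SiegelTwo σ (ShFeld σ.Istar H L₀) := by
  classical
  set B : Finset (ℕ × ((Fin S.d → ℤ) × ℤ)) := famBox L₀ (σ.Dbox 0) (σ.Dθ 0) with hBdef
  set E : Finset (ℤ × Tau S.d) := eqSet S.d (σ.N0 0) (σ.T0 0) with hEdef
  set R : ℕ × ((Fin S.d → ℤ) × ℤ) → ℚ[X] := fun i => feldRs i.1 H σ.Istar with hRdef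
  set u : ℕ × ((Fin S.d → ℤ) × ℤ) → Fin S.d → ℤ := fun i => i.2.1 with hudef
  set uθ : ℕ × ((Fin S.d → ℤ) × ℤ) → ℤ := fun i => i.2.2 with huθdef
  have hbox := S.feldman_box_le B (subset_refl _)
  have hlcm1 : 1 ≤ Nat.lcmUpto H := Nat.lcmUpto_pos H
  have hden₀1 : ∀ e ∈ E, 1 ≤ σ.den₀ 0 e.1 e.2 := by
    intro e _; rw [hden₀]; exact Nat.one_le_pow _ _ hlcm1
  have hhasse : ∀ i ∈ B, ∀ (x : ℤ) (τ : Tau S.d), ∃ z₀ : ℤ,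
      (σ.den₀ 0 x τ : ℚ) * (hasseDeriv τ.1 (R i)).eval (x : ℚ) = z₀ ∧ |z₀| ≤ σ.M₀ 0 x τ := by
    intro i hi x τ
    rw [hden₀]
    have h := exists_int_lcm_pow_mul_hasse_feldRs i.1 hH σ.Istar τ.1 x
      (hM₀ x τ i.1 (mem_famBox.mp hi).1)
    simpa only [hRdef] using h
  have hR : ∀ e ∈ E, ∀ i ∈ B, ∃ z₀ : ℤ,
      ((σ.den₀ 0 e.1 e.2 : ℕ) : ℚ) * (hasseDeriv e.2.1 (R i)).eval (e.1 : ℚ) = z₀ ∧ |z₀| ≤ M₀E := by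
    intro e he i hi
    obtain ⟨z₀, hz₀, hle⟩ := hhasse i hi e.1 e.2
    exact ⟨z₀, hz₀, hle.trans (hM₀E e he)⟩
  obtain ⟨𝔏, p, h𝔏B, _hcnt, _h𝔏ne, hslab, hsupp, ⟨i₀, hpi₀⟩, hpbd, hsol⟩ :=
    S.exists_g3_slab_siegel R u uθ B σ.m hΛ E (eqSet_nonempty S.d (σ.N0 0) hT0) hE hbox.1 hbox.2
      (fun e => σ.den₀ 0 e.1 e.2) hden₀1 hR hXb hAmax hA
  have hi₀ : i₀ ∈ 𝔏 := hsupp i₀ hpi₀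
  have h𝔏card : 𝔏.card ≤ B.card := card_le_card h𝔏B
  have hdegs := S.feldRs_degrees H σ.Istar hL 𝔏 h𝔏B
  have hρ1 : (1 : ℝ) ≤ 4 * (2 : ℝ) ^ σ.m := by
    have : (1 : ℝ) ≤ 2 ^ σ.m := one_le_pow₀ (by norm_num)
    nlinarith
  refine ⟨⟨𝔏, R, u, uθ, p, i₀⟩, ?_, ?_⟩
  · exact
      { card_le := h𝔏card.trans hcardB
        exists_ne := ⟨i₀, hi₀, hpi₀⟩
        deg_ne := hdegs.1
        R_ne := hdegs.2.1
        deg_le := hdegs.2.2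
        p_le := by
          intro i _
          refine (hpbd i).trans (le_trans ?_ hP)
          exact Int.ceil_le_ceil (mul_le_mul_of_nonneg_right (by exact_mod_cast h𝔏card)
            (le_trans zero_le_one hAmax))
        u_le := (S.feldman_box_le 𝔏 h𝔏B).1
        uθ_le := (S.feldman_box_le 𝔏 h𝔏B).2
        dir_le := fun i hi j => hXb i (h𝔏B hi) j
        slab := hslab i₀ hi₀
        wt := fun i hi t₀ k =>
          (norm_coeff_hw_feldRs_mul_pow_le (fun i : ℕ × ((Fin S.d → ℤ) × ℤ) => i.1) H σ.Istar i t₀ k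
            hρ1).trans (hBw i.1 (mem_famBox.mp (h𝔏B hi)).1)
        hasse := fun i hi x τ => hhasse i (h𝔏B hi) x τ
        shape := fun i hi => ⟨(mem_famBox.mp (h𝔏B hi)).1, by rw [Nat.sub_zero]⟩ }
  · rw [G3Fam.vanish_all_iff]
    exact vanish_of_eqSet S R u uθ 𝔏 p hsol

/-! ### The record bundle with the sharp count -/

/-- **THE RECORD'S COMPLETE OBLIGATION LIST FOR THE ANALYTIC FRAME, SHARP COUNT** (= `FrameNumericsTwo` with
`count` replaced by the binomial count `2·2^m·(2N₀+1)·binom(T₀+d, d+1) ≤ (L₀+1)·∏(2Dboxⱼ+1)·(2D_θ+1)`).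
[cite: Yu2013, §3.1 (3.1)–(3.9) and (4.30); shape only] -/
structure FrameNumericsTwoC (H L₀ : ℕ) : Prop where
  /-- the Fel'dman block is nonempty -/
  one_le_H : 1 ≤ H
  /-- at least one order at level `0` -/
  T0_pos : 1 ≤ σ.T0 0
  /-- Siegel's count on the slab class, sharp: `2·2^m·(2N₀+1)·binom(T₀+d, d+1) ≤ #box` -/
  count : 2 * 2 ^ σ.m * ((2 * σ.N0 0 + 1) * (σ.T0 0 + S.d).choose (S.d + 1)) ≤
    (L₀ + 1) * ((∏ j, (2 * σ.Dbox 0 j + 1)) * (2 * σ.Dθ 0 + 1))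
  /-- the family-size slot at level `0` -/
  cardB0 : (famBox L₀ (σ.Dbox 0) (σ.Dθ 0)).card ≤ σ.cardB 0
  /-- the `Y₀`-degree slot -/
  L_le : L₀ ≤ σ.D₀
  /-- the directional slot at level `0` -/
  Xb0 : ∀ i ∈ famBox L₀ (σ.Dbox 0) (σ.Dθ 0), ∀ j, |S.dirScalar i.2.1 i.2.2 j| ≤ σ.Xb 0
  /-- the `2`-adic weight line at level `0` (radius `4·2^m`) -/
  Bw0 : ∀ ℓ, ℓ ≤ L₀ → ‖((den ℓ H : ℚ_[2]))⁻¹‖ * (4 * (2 : ℝ) ^ σ.m) ^ ℓ ≤ σ.Bw 0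
  /-- the `Y₀`-weight denominators are `ν(H)^t` at every level -/
  den₀_eq : ∀ (I : ℕ) (x : ℤ) (τ : Tau S.d), σ.den₀ I x τ = Nat.lcmUpto H ^ τ.1
  /-- Fel'dman's Hasse sizes at the points `3^{I*−I}x`, every level `I ≤ I*` -/
  M₀_ge : ∀ I, I ≤ σ.Istar → ∀ (x : ℤ) (τ : Tau S.d), ∀ ℓ, ℓ ≤ L₀ →
    (3 : ℝ) ^ ((σ.Istar - I) * τ.1) * ((Nat.lcmUpto H : ℝ) ^ τ.1 *
      (Real.exp (H / Real.exp 1) * (Real.exp 1 * (1 + (3 : ℝ) ^ (σ.Istar - I) * |(x : ℝ)| / H)) ^ ℓ)) ≤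
      σ.M₀ I x τ
  /-- the level-`0` Siegel size `Amax` and the coefficient slot `P` -/
  level0_size : ∃ (M₀E : ℤ) (Amax : ℝ), (∀ e ∈ eqSet S.d (σ.N0 0) (σ.T0 0), σ.M₀ 0 e.1 e.2 ≤ M₀E) ∧
    1 ≤ Amax ∧ (∀ e ∈ eqSet S.d (σ.N0 0) (σ.T0 0), (M₀E : ℝ) * (σ.Xb 0 : ℝ) ^ (∑ j, e.2.2 j) *
      ((MonomialDen.monDen S.toQ.all (S.boxExp (σ.Dbox 0) (σ.Dθ 0) e.1) : ℝ)) ^ 2 ≤ Amax) ∧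
    ⌈((famBox L₀ (σ.Dbox 0) (σ.Dθ 0)).card : ℝ) * Amax⌉ ≤ σ.P
  /-- the inner-chain numerics of every level -/
  kfinal : ∀ I, I ≤ σ.Istar → KFinalTwo σ I
  /-- the third-step numerics of every level below the last -/
  third : ∀ I, I < σ.Istar → ThirdFinalTwo σ I

/-- **THE LEVELS FROM THE NUMBERS (sharp count).** [cite: Yu2013, §5 (5.19)–(5.20); shape only] -/
theorem levels_of_numericsC {H L₀ : ℕ} (hnum : FrameNumericsTwoC σ H L₀)
    (hΛ : ‖S.Λ₀‖ ≤ ((2 : ℝ) ^ (σ.m + 3))⁻¹)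
    (hK : ∀ κ : Fin (S.d + 1) → ℕ, (∃ j, ¬ 3 ∣ κ j) → ∀ γ : ℚ, ∏ j, S.toQ.all j ^ κ j ≠ γ ^ 3) :
    SiegelTwo σ (ShFeld σ.Istar H L₀) ∧ (∀ I, I ≤ σ.Istar → KChainTwo σ (ShFeld σ.Istar H L₀) I) ∧
      (∀ I, I < σ.Istar → ThirdStepTwo σ (ShFeld σ.Istar H L₀) I) := by
  obtain ⟨M₀E, Amax, hM₀E, hAmax, hA, hP⟩ := hnum.level0_size
  refine ⟨?_, fun I hI => kchainTwo_of_kfinal σ _ (hnum.kfinal I hI), fun I hI => ?_⟩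
  · refine siegelTwo_feldman_scaled_of_card σ H L₀ hnum.one_le_H hΛ hnum.T0_pos
      (siegel_count_choose σ.m L₀ (σ.Dbox 0) (σ.Dθ 0) (σ.N0 0) (σ.T0 0) hnum.count) hnum.cardB0 hnum.L_le
      hnum.Xb0 hnum.Bw0 (hnum.den₀_eq 0) ?_ hM₀E hAmax hA hP
    intro x τ ℓ hℓ
    have h := hnum.M₀_ge 0 (Nat.zero_le _) x τ ℓ hℓ
    simpa only [Nat.sub_zero] using h
  · exact thirdStepTwo_of σ _ (hnum.third I hI)
      (basisStepTwo_feld σ hnum.one_le_H hI (hnum.den₀_eq (I + 1)) (hnum.M₀_ge (I + 1) hI)) hK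

/-- **`FrameTwoLast C d` FROM THE RECORD (sharp count).** [cite: Yu2013, §5–§6; shape only] -/
theorem frameTwoLast_of_numericsC {C : ℕ → ℝ} {d : ℕ}
    (h : ∀ (α : Fin (d + 1) → ℚ) (b : Fin (d + 1) → ℤ) (V : Fin (d + 1) → ℝ) (Vmax W : ℝ)
      (hα : ∀ j, 3 ≤ padicValRat 2 (α j - 1)),
      (∀ μ : Fin (d + 1) → ℤ, ∏ j, α j ^ μ j = 1 → μ = 0) →
      (∀ κ : Fin (d + 1) → ℤ, (∃ γ : ℚ, ∏ j, α j ^ κ j = γ ^ 3) → ∀ j, (3 : ℤ) ∣ κ j) →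
      (∀ j, Height.logHeight₁ (α j) ≤ V j) → (∀ j, 1 ≤ V j) → (∀ j, V j ≤ Vmax) →
      ∀ (hb : b (Fin.last d) ≠ 0)
        (hmin : ∀ j, b j ≠ 0 → padicValInt 2 (b (Fin.last d)) ≤ padicValInt 2 (b j)),
      (∀ j, Real.log (max 3 (|b j| : ℝ)) ≤ W) → 1 ≤ W →
      ¬ (padicValRat 2 (∏ j, α j ^ b j - 1) : ℝ) ≤ C (d + 1) * (∏ j, V j) * (W + Real.log (2 * Vmax)) →
      ∃ (σ : (ofData d α b hα hb hmin).G3TwoSched) (H L₀ S₀ X : ℕ),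
        FrameNumericsTwoC σ H L₀ ∧ ‖(ofData d α b hα hb hmin).Λ₀‖ ≤ ((2 : ℝ) ^ (σ.m + 3))⁻¹ ∧
        (d + 1 + 1) * X ≤ σ.Nfin σ.Istar ∧ (d + 1 + 1) * S₀ < σ.Tfin σ.Istar ∧
        GenThreeFrameSpecTwo.RecordTwo C (d + 1) V Vmax W σ.D₀ S₀ X
          (Fin.snoc (σ.Dbox σ.Istar) (σ.Dθ σ.Istar))) :
    GenThreeFramePivotTwo.FrameTwoLast C d := by
  refine frameTwoLast_of_mainTwo fun α b V Vmax W hα hind hKZ hV hV1 hVmax hb hmin hW hW1 hneg => ?_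
  obtain ⟨σ, H, L₀, S₀, X, hnum, hΛ, hX, hT, hrec⟩ :=
    h α b V Vmax W hα hind hKZ hV hV1 hVmax hb hmin hW hW1 hneg
  have hK : ∀ κ : Fin (d + 1) → ℕ, (∃ j, ¬ 3 ∣ κ j) → ∀ γ : ℚ,
      ∏ j, (ofData d α b hα hb hmin).toQ.all j ^ κ j ≠ γ ^ 3 := by
    rw [ofData_all]
    exact KummerBasisChange.kummerNat_of_kummerInt 3 α hKZ
  obtain ⟨hS, hk, hth⟩ := levels_of_numericsC σ hnum hΛ hK
  exact ⟨_, σ, ShFeld σ.Istar H L₀, S₀, X, hS, hk, hth, hX, hT, hrec⟩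

/-- **THE REGISTERED STUB'S TEXT FROM THE RECORD (sharp count)** — the form to use for `stub_frameTwoLast` of
crux stmt-ABC-19659. [cite: Yu2007, Main Thm (K = ℚ, ℘ = 2); shape only] -/
theorem stub_frameTwoLast_of_numericsC {C : ℕ → ℝ} {c₁ : ℝ} (hc₁ : 1 ≤ c₁)
    (hC : ∀ m, 0 ≤ C m ∧ C m ≤ c₁ ^ m) (hC1 : 4 ≤ C 1)
    (h : Nesterenko2003_prop51 → ∀ d, 1 ≤ d →
      ∀ (α : Fin (d + 1) → ℚ) (b : Fin (d + 1) → ℤ) (V : Fin (d + 1) → ℝ) (Vmax W : ℝ)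
      (hα : ∀ j, 3 ≤ padicValRat 2 (α j - 1)),
      (∀ μ : Fin (d + 1) → ℤ, ∏ j, α j ^ μ j = 1 → μ = 0) →
      (∀ κ : Fin (d + 1) → ℤ, (∃ γ : ℚ, ∏ j, α j ^ κ j = γ ^ 3) → ∀ j, (3 : ℤ) ∣ κ j) →
      (∀ j, Height.logHeight₁ (α j) ≤ V j) → (∀ j, 1 ≤ V j) → (∀ j, V j ≤ Vmax) →
      ∀ (hb : b (Fin.last d) ≠ 0)
        (hmin : ∀ j, b j ≠ 0 → padicValInt 2 (b (Fin.last d)) ≤ padicValInt 2 (b j)),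
      (∀ j, Real.log (max 3 (|b j| : ℝ)) ≤ W) → 1 ≤ W →
      ¬ (padicValRat 2 (∏ j, α j ^ b j - 1) : ℝ) ≤ C (d + 1) * (∏ j, V j) * (W + Real.log (2 * Vmax)) →
      ∃ (σ : (ofData d α b hα hb hmin).G3TwoSched) (H L₀ S₀ X : ℕ),
        FrameNumericsTwoC σ H L₀ ∧ ‖(ofData d α b hα hb hmin).Λ₀‖ ≤ ((2 : ℝ) ^ (σ.m + 3))⁻¹ ∧
        (d + 1 + 1) * X ≤ σ.Nfin σ.Istar ∧ (d + 1 + 1) * S₀ < σ.Tfin σ.Istar ∧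
        GenThreeFrameSpecTwo.RecordTwo C (d + 1) V Vmax W σ.D₀ S₀ X
          (Fin.snoc (σ.Dbox σ.Istar) (σ.Dθ σ.Istar))) :
    ∃ (C : ℕ → ℝ) (c₁ : ℝ), 1 ≤ c₁ ∧ (∀ m, 0 ≤ C m ∧ C m ≤ c₁ ^ m) ∧ 4 ≤ C 1 ∧
      (Nesterenko2003_prop51 → ∀ d, 1 ≤ d → GenThreeFramePivotTwo.FrameTwoLast C d) :=
  ⟨C, c₁, hc₁, hC, hC1, fun hZ d hd => frameTwoLast_of_numericsC (h hZ d hd)⟩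

end TwoSetup

end Summit.ABC.StewartYu

end
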